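import Summits.ValiantsHypothesis.ValiantsHypothesis.Theorems.KPlusLogSqLawTridiagonalRealStaticUnitRows

/-!
# Route «KPlusLogSqLaw», crux `WeakLifting` (stmt-ValiantsHypothesis-19561) — REAL side of the tridiagonal sector:
# the UNIT-COEFFICIENT sub-sector — a ONE-SIGNED design of size 9 with FIVE positive zeros (the one-signed cap `⌊m/2⌋` fails at `m = 9`, kernel)

HONEST FRAMING.  Helper theorems (`--supports stmt-ValiantsHypothesis-19561 --as helper`), seat val-sym-lift-p1 (g19), cell `pub-symmetroid`,
2026-08-28; companion of `…UnitMonotoneInertia` (p642748: sizes `3,4,5,6,8` ⇒ every one-signed unit design has `≤ ⌊m/2⌋` positive zeros) and of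
`…UnitSevenOneSignedFour` (p644354: a one-signed size-7 design with four).  SIZE 9: the unit design with diagonal exponents
`d = (1,0,1,0,1,1,1,0,0)` and link exponents `f = (4,5,1,3,7,4,1,7)` has ALL EDGE SLOPES POSITIVE, `L = (7, 9, 1, 5, 12, 6, 1, 14)`, and
`D₉ = X⁵·Q`, `Q = 1 − 2X + X² − X⁵ + 2X⁸ − 2X⁹ + X¹⁰ + X¹¹ + 2X¹³ − 2X¹⁴ + X¹⁵ − X¹⁸ + 2X¹⁹ − 2X²⁰ + 2X²¹ − 2X²² + X²³ − X²⁵ − 2X²⁷ − X²⁹ + X³² − X³³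
+ 2X³⁴ − X³⁵`, with signs `+ − + − + −` at `1/2, 3/4, 4/5, 1, 3/2, 3`: at least FIVE distinct positive zeros (`exists_unit_nine_oneSigned_five_le_card`;
located: exactly five by exact Sturm — three below the resonance (`= ⌊9/3⌋`, the inertia floor of `…UnitInertiaFloor` is attained) and TWO ABOVE it,
a dominant-side reversal as at size 7).  So the one-signed cap `Z ≤ ⌊m/2⌋` (kernel for `m ∈ {3,4,5,6,8}`) fails at `m = 7` AND at `m = 9` by
small integer witnesses (the earlier size-9 failure of record, val-sym-lift-p2 g18, was a located recessive-side witness of degree 34 189).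
Found by the seat's probe tools/m9_pattern_search.py (insertions around the size-7 pattern, slopes ≤ 15).  Nothing here is an upper law for the
register (α NO MOVER); nothing bears on `WeakLifting` / `TropicalB` (stmt-19771) in their windows, Conjecture B, the Door-A registers,
`MatrixDescartes` (stmt-18050) or VP ≠ VNP.
[this seat; folklore: continuants ↔ matchings of the path, IVT sign certificates]
-/

-- `Summit.ValiantsHypothesis.ValiantsHypothesis.…` repeats a component by the D-0017 layout (single-conjunct summit); the name is mandated.
set_option linter.dupNamespace false
set_option autoImplicit false

namespace Summit.ValiantsHypothesis.ValiantsHypothesis.Theorems.KPlusLogSqLaw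
namespace StaticTridiagonalRealUnit

open Polynomial Finset
open Summit.ValiantsHypothesis.ValiantsHypothesis.Theorems.KPlusLogSqLaw.StaticTridiagonalRealPotential (pathDet)
open Summit.ValiantsHypothesis.ValiantsHypothesis.Theorems.SymmetroidDescartes (le_card_posRoots_of_alternating)

/-- the one-signed size-`9` design `d = (1,0,1,0,1,1,1,0,0)`, `f = (4,5,1,3,7,4,1,7)` (slopes `(7,9,1,5,12,6,1,14)`): `D₉ = X⁵·Q` with the
degree-35 polynomial `Q` of the module docstring. [this file] -/
theorem eval_unit_nine_oneSigned (x : ℝ) :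
    (pathDet (fun _ => (1 : ℝ)) (fun t => if t = 0 ∨ t = 2 ∨ t = 4 ∨ t = 5 ∨ t = 6 then 1 else 0) (fun _ => (1 : ℝ))
        (fun t => if t = 0 then 4 else if t = 1 then 5 else if t = 2 then 1 else if t = 3 then 3 else if t = 4 then 7 else if t = 5 then 4
          else if t = 6 then 1 else 7) 9).eval x =
      x ^ 5 * (1 - 2 * x + x ^ 2 - x ^ 5 + 2 * x ^ 8 - 2 * x ^ 9 + x ^ 10 + x ^ 11 + 2 * x ^ 13 - 2 * x ^ 14 + x ^ 15 - x ^ 18 + 2 * x ^ 19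
        - 2 * x ^ 20 + 2 * x ^ 21 - 2 * x ^ 22 + x ^ 23 - x ^ 25 - 2 * x ^ 27 - x ^ 29 + x ^ 32 - x ^ 33 + 2 * x ^ 34 - x ^ 35) := by
  obtain ⟨e0, e1⟩ := eval_unit_zero_one (fun t => if t = 0 ∨ t = 2 ∨ t = 4 ∨ t = 5 ∨ t = 6 then 1 else 0)
    (fun t => if t = 0 then 4 else if t = 1 then 5 else if t = 2 then 1 else if t = 3 then 3 else if t = 4 then 7 else if t = 5 then 4
      else if t = 6 then 1 else 7) x
  have e := fun n => eval_unit_add_two (fun t => if t = 0 ∨ t = 2 ∨ t = 4 ∨ t = 5 ∨ t = 6 then 1 else 0)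
    (fun t => if t = 0 then 4 else if t = 1 then 5 else if t = 2 then 1 else if t = 3 then 3 else if t = 4 then 7 else if t = 5 then 4
      else if t = 6 then 1 else 7) x n
  have e2 := e 0
  have e3 := e 1
  have e4 := e 2
  have e5 := e 3
  have e6 := e 4
  have e7 := e 5
  have e8 := e 6
  have e9 := e 7
  simp only [zero_add] at e2
  rw [e9, e8, e7, e6, e5, e4, e3, e2, e1, e0]
  norm_num
  ring

/-- the slopes of the design are all positive: `d_k + d_{k+1} < 2f_k` for `k < 8`. [this file] -/
theorem slopes_pos_unit_nine_oneSigned :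
    ∀ k, k + 1 < 9 → (fun t : ℕ => if t = 0 ∨ t = 2 ∨ t = 4 ∨ t = 5 ∨ t = 6 then 1 else 0) k
        + (fun t : ℕ => if t = 0 ∨ t = 2 ∨ t = 4 ∨ t = 5 ∨ t = 6 then 1 else 0) (k + 1) <
      2 * (fun t : ℕ => if t = 0 then 4 else if t = 1 then 5 else if t = 2 then 1 else if t = 3 then 3 else if t = 4 then 7 else if t = 5 then 4
        else if t = 6 then 1 else 7) k := by
  intro k hk
  have : k = 0 ∨ k = 1 ∨ k = 2 ∨ k = 3 ∨ k = 4 ∨ k = 5 ∨ k = 6 ∨ k = 7 := by omega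
  rcases this with rfl | rfl | rfl | rfl | rfl | rfl | rfl | rfl <;> simp

/-- **A ONE-SIGNED SIZE-9 UNIT DESIGN WITH FIVE POSITIVE ZEROS**: there is a unit-coefficient static symmetric tridiagonal design of size `9` with
ALL edge slopes positive and at least five distinct positive determinant zeros (signs `+ − + − + −` at `1/2, 3/4, 4/5, 1, 3/2, 3`; two of the zeros
lie above the resonance) — the one-signed cap `Z ≤ ⌊m/2⌋` of sizes `3,4,5,6,8` (`…UnitMonotoneInertia.card_posRoots_le_half`) fails at `m = 9`
(kernel; at `m = 7` by `…UnitSevenOneSignedFour`). [this file] -/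
theorem exists_unit_nine_oneSigned_five_le_card :
    ∃ d f : ℕ → ℕ, (∀ k, k + 1 < 9 → d k + d (k + 1) < 2 * f k) ∧
      5 ≤ ((pathDet (fun _ => (1 : ℝ)) d (fun _ => (1 : ℝ)) f 9).roots.toFinset.filter (fun x => 0 < x)).card := by
  refine ⟨fun t => if t = 0 ∨ t = 2 ∨ t = 4 ∨ t = 5 ∨ t = 6 then 1 else 0,
    fun t => if t = 0 then 4 else if t = 1 then 5 else if t = 2 then 1 else if t = 3 then 3 else if t = 4 then 7 else if t = 5 then 4
      else if t = 6 then 1 else 7,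
    slopes_pos_unit_nine_oneSigned, le_card_posRoots_of_alternating _ 5 (![1 / 2, 3 / 4, 4 / 5, 1, 3 / 2, 3] : Fin 6 → ℝ) ?_ ?_ ?_⟩
  · refine Fin.strictMono_iff_lt_succ.2 fun j => ?_
    fin_cases j <;> norm_num [Matrix.cons_val_two, Matrix.tail_cons, Matrix.head_cons]
  · intro j; fin_cases j <;> norm_num [Matrix.cons_val_two, Matrix.tail_cons, Matrix.head_cons]
  · intro j; fin_cases j <;> norm_num [Matrix.cons_val_two, Matrix.tail_cons, Matrix.head_cons, eval_unit_nine_oneSigned]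

end StaticTridiagonalRealUnit
end Summit.ValiantsHypothesis.ValiantsHypothesis.Theorems.KPlusLogSqLaw
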